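import Mathlib
import Literature.Analysis.ODE.SchrodingerODE
import HarnessLib

/-!
# A dominant partner of Wronskian one for the recessive solution `u₀ ~ x^{-ℓ}` of `u'' = V u`

Analysis/ODE support file (everything proved, no definitions). Let `V` be continuous and `u₀` a global
classical solution of `u'' = V u` (`IsSchrodingerSol V u₀`) which beyond `x₀ ≥ 1` is comparable to
`x^{-ℓ}`: `5/8 ≤ x^ℓ u₀(x) ≤ 11/8` and `x^{ℓ+1}|u₀'(x)| ≤ ℓ + 1` for `x > x₀` (the output of the
Volterra construction `VolterraRecessiveInverseSquare.lean`, see `recessive_npow_bounds`). Then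
(`exists_dominant_wronskian_one`) the global solution `u₁` with `u₁(x₀+1) = 0`,
`u₁'(x₀+1) = 1/u₀(x₀+1)` has Wronskian `u₀u₁' − u₀'u₁ ≡ 1`, equals `u₀ ∫_{x₀+1}^x u₀^{-2}` beyond `x₀`
(reduction of order + uniqueness of the phase curve), and satisfies on `[x₀+1, ∞)`

  `0 ≤ u₁(x) ≤ 5 x^{ℓ+1}`,   `|u₁'(x)| ≤ 5 x^ℓ`.

`exists_fundamental_pair_rpow` repackages `(u₀, u₁)` with real-power bounds
(`|u₀| ≤ (ℓ+2)x^{-ℓ}`, `|u₀'| ≤ (ℓ+2)x^{-ℓ-1}`, `|u₁| ≤ 5x^{ℓ+1}`, `|u₁'| ≤ 5x^ℓ`, `u₀ > 0`) — the input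
format of the sourced right inverses of `SourcedRightInverse.lean`. Standard (P. Hartman, *Ordinary
Differential Equations*, Ch. XI §6 (principal / non-principal solutions); folklore). Use: the true
far-side t-polynomial kernel of the Regge–Wheeler channel estimate `FixedModeChannels`
(route PhotonSphereChannels, stmt-FinalStateConjecture-10048).
-/

noncomputable section

namespace Literature.Analysis.ODE

open MeasureTheory Set Filter Topology intervalIntegral

section Dominant

variable {V u₀ : ℝ → ℝ} {x₀ : ℝ}

/-- From the Volterra bounds `|x^ℓ u₀ − 1| ≤ 3/8`, `|u₀' + ℓx^{-ℓ-1}| ≤ x^{-ℓ-1}/4` (`x > 0`) to the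
two-sided comparison with `x^{-ℓ}`: `5/8 ≤ x^ℓ u₀ ≤ 11/8` and `x^{ℓ+1}|u₀'| ≤ ℓ + 1`. [folklore] -/
theorem recessive_npow_bounds {ℓ : ℕ} {x : ℝ} (hx : 0 < x) (h1 : |x ^ ℓ * u₀ x - 1| ≤ 3 / 8)
    (h2 : |deriv u₀ x + ℓ * x ^ (-(ℓ : ℤ) - 1)| ≤ 1 / 4 * x ^ (-(ℓ : ℤ) - 1)) :
    5 / 8 ≤ x ^ ℓ * u₀ x ∧ x ^ ℓ * u₀ x ≤ 11 / 8 ∧ x ^ (ℓ + 1) * |deriv u₀ x| ≤ ℓ + 1 := by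
  obtain ⟨h1a, h1b⟩ := abs_le.1 h1
  refine ⟨by linarith, by linarith, ?_⟩
  have hz : x ^ (-(ℓ : ℤ) - 1) * x ^ (ℓ + 1) = 1 := by
    rw [← zpow_natCast, ← zpow_add₀ hx.ne']
    have : (-(ℓ : ℤ) - 1 + ((ℓ + 1 : ℕ) : ℤ)) = 0 := by push_cast; ring
    rw [this, zpow_zero]
  have hzp : 0 < x ^ (-(ℓ : ℤ) - 1) := zpow_pos hx _
  have hxp : 0 < x ^ (ℓ + 1) := pow_pos hx _
  -- multiply the derivative bound by `x^{ℓ+1}`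
  have h3 : |deriv u₀ x| ≤ ((ℓ : ℝ) + 1 / 4) * x ^ (-(ℓ : ℤ) - 1) := by
    have hℓz : 0 ≤ (ℓ : ℝ) * x ^ (-(ℓ : ℤ) - 1) := by positivity
    calc |deriv u₀ x| = |(deriv u₀ x + ℓ * x ^ (-(ℓ : ℤ) - 1)) - ℓ * x ^ (-(ℓ : ℤ) - 1)| := by
          rw [add_sub_cancel_right]
      _ ≤ |deriv u₀ x + ℓ * x ^ (-(ℓ : ℤ) - 1)| + |(ℓ : ℝ) * x ^ (-(ℓ : ℤ) - 1)| := abs_sub _ _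
      _ ≤ 1 / 4 * x ^ (-(ℓ : ℤ) - 1) + ℓ * x ^ (-(ℓ : ℤ) - 1) := by
          rw [abs_of_nonneg hℓz]; exact add_le_add h2 le_rfl
      _ = ((ℓ : ℝ) + 1 / 4) * x ^ (-(ℓ : ℤ) - 1) := by ring
  calc x ^ (ℓ + 1) * |deriv u₀ x| ≤ x ^ (ℓ + 1) * (((ℓ : ℝ) + 1 / 4) * x ^ (-(ℓ : ℤ) - 1)) := by
        gcongr
    _ = ((ℓ : ℝ) + 1 / 4) * (x ^ (-(ℓ : ℤ) - 1) * x ^ (ℓ + 1)) := by ring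
    _ ≤ ℓ + 1 := by rw [hz, mul_one]; linarith

/-- **Dominant partner with Wronskian one.** See the module docstring. [folklore] -/
theorem exists_dominant_wronskian_one (hV : Continuous V) {ℓ : ℕ} (hx₀ : 1 ≤ x₀)
    (hu₀ : IsSchrodingerSol V u₀) (hp : ∀ x, x₀ < x → 5 / 8 ≤ x ^ ℓ * u₀ x)
    (hP : ∀ x, x₀ < x → x ^ ℓ * u₀ x ≤ 11 / 8)
    (hd : ∀ x, x₀ < x → x ^ (ℓ + 1) * |deriv u₀ x| ≤ ℓ + 1) :
    ∃ u₁ : ℝ → ℝ, IsSchrodingerSol V u₁ ∧ (∀ x, u₀ x * deriv u₁ x - deriv u₀ x * u₁ x = 1) ∧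
      ∀ x, x₀ + 1 ≤ x → 0 ≤ u₁ x ∧ u₁ x ≤ 5 * x ^ (ℓ + 1) ∧ |deriv u₁ x| ≤ 5 * x ^ ℓ := by
  set x₁ : ℝ := x₀ + 1 with hx₁
  have hpos : ∀ x, x₀ < x → 0 < u₀ x := by
    intro x hx
    have h := hp x hx
    have hxl : 0 < x ^ ℓ := pow_pos (by linarith) _
    rcases le_or_gt (u₀ x) 0 with hneg | h'
    · nlinarith [mul_nonpos_of_nonneg_of_nonpos hxl.le hneg]
    · exact h'
  have hx₁0 : x₀ < x₁ := by simp only [hx₁]; linarith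
  have hu₀x₁ : u₀ x₁ ≠ 0 := (hpos x₁ hx₁0).ne'
  -- the partner and its Wronskian
  obtain ⟨u₁, hu₁, hu₁0, hu₁1⟩ := exists_isSchrodingerSol hV x₁ 0 (u₀ x₁)⁻¹
  set w : ℝ → ℝ := fun x => u₀ x * deriv u₁ x - deriv u₀ x * u₁ x with hw
  have hwd : ∀ x, HasDerivAt w 0 x := by
    intro x
    have h := ((hu₀.hasDerivAt x).mul (hu₁.hasDerivAt_deriv x)).sub
      ((hu₀.hasDerivAt_deriv x).mul (hu₁.hasDerivAt x))
    refine h.congr_deriv ?_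
    ring
  have hw1 : ∀ x, w x = 1 := by
    intro x
    have hc := is_const_of_deriv_eq_zero (fun y => (hwd y).differentiableAt)
      (fun y => (hwd y).deriv) x x₁
    rw [hc]
    simp only [hw, hu₁0, hu₁1, mul_zero, sub_zero]
    exact mul_inv_cancel₀ hu₀x₁
  -- reduction of order: `ψ = u₀ ∫_{x₁}^x u₀^{-2}` solves the equation on `(x₀, ∞)`
  set g₂ : ℝ → ℝ := fun y => ((u₀ y) ^ 2)⁻¹ with hg₂
  have hg₂c : ContinuousOn g₂ (Ioi x₀) := by
    refine ContinuousOn.inv₀ ((hu₀.continuous.pow 2).continuousOn) fun y hy => ?_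
    exact pow_ne_zero 2 (hpos y hy).ne'
  set F : ℝ → ℝ := fun x => ∫ y in x₁..x, g₂ y with hF
  have hFd : ∀ x, x₀ < x → HasDerivAt F (g₂ x) x := by
    intro x hx
    have hsub : uIcc x₁ x ⊆ Ioi x₀ := ordConnected_Ioi.uIcc_subset hx₁0 hx
    exact intervalIntegral.integral_hasDerivAt_right ((hg₂c.mono hsub).intervalIntegrable)
      (hg₂c.stronglyMeasurableAtFilter isOpen_Ioi x hx) (hg₂c.continuousAt (Ioi_mem_nhds hx))
  set ψ : ℝ → ℝ := fun x => u₀ x * F x with hψ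
  set ψ' : ℝ → ℝ := fun x => deriv u₀ x * F x + (u₀ x)⁻¹ with hψ'
  have hψd : ∀ x, x₀ < x → HasDerivAt ψ (ψ' x) x := by
    intro x hx
    have hne := (hpos x hx).ne'
    have h := (hu₀.hasDerivAt x).mul (hFd x hx)
    refine h.congr_deriv ?_
    simp only [hψ', hg₂]
    field_simp
  have hψ'd : ∀ x, x₀ < x → HasDerivAt ψ' (V x * ψ x) x := by
    intro x hx
    have hne := (hpos x hx).ne'
    have h := ((hu₀.hasDerivAt_deriv x).mul (hFd x hx)).add ((hu₀.hasDerivAt x).inv hne)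
    refine h.congr_deriv ?_
    simp only [hψ, hg₂]
    field_simp
    ring
  -- uniqueness of the phase curve on `(x₀, b)`
  have hEq : ∀ x, x₀ < x → u₁ x = ψ x ∧ deriv u₁ x = ψ' x := by
    intro x hx
    set b : ℝ := max x x₁ + 1 with hb
    have hxb : x < b := by simp only [hb]; linarith [le_max_left x x₁]
    have h1b : x₁ < b := by simp only [hb]; linarith [le_max_right x x₁]
    obtain ⟨K, -, -, hK⟩ := exists_const_schrodingerField hV x₀ b
    have hF0 : F x₁ = 0 := by simp only [hF, integral_same]
    have key := ODE_solution_unique_of_mem_Ioo (v := schrodingerField V) (s := fun _ => univ)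
      (K := K) (f := fun s => (u₁ s, deriv u₁ s)) (g := fun s => (ψ s, ψ' s))
      (a := x₀) (b := b) (t₀ := x₁)
      (fun τ hτ => ((hK τ (Ioo_subset_Icc_self hτ)).1).lipschitzOnWith) ⟨hx₁0, h1b⟩
      (fun τ _ => ⟨hu₁.hasDerivAt_phase τ, mem_univ _⟩)
      (fun τ hτ => ⟨(hψd τ hτ.1).prodMk (hψ'd τ hτ.1), mem_univ _⟩)
      (by simp [hψ, hψ', hu₁0, hu₁1, hF0]) ⟨hx, hxb⟩
    exact ⟨congrArg Prod.fst key, congrArg Prod.snd key⟩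
  -- bounds on `[x₁, ∞)`
  refine ⟨u₁, hu₁, hw1, fun x hx => ?_⟩
  have hxx₀ : x₀ < x := lt_of_lt_of_le hx₁0 hx
  have hx0 : 0 < x := by linarith
  have hx1 : 1 ≤ x := by linarith
  obtain ⟨e1, e2⟩ := hEq x hxx₀
  -- `0 ≤ F x ≤ (64/25) x^{2ℓ+1}/(2ℓ+1)`
  have hIcc : ∀ y ∈ Icc x₁ x, x₀ < y := fun y hy => lt_of_lt_of_le hx₁0 hy.1
  have hg₂b : ∀ y ∈ Icc x₁ x, 0 ≤ g₂ y ∧ g₂ y ≤ 64 / 25 * y ^ (2 * ℓ) := by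
    intro y hy
    have hy0 : x₀ < y := hIcc y hy
    have hu : 0 < u₀ y := hpos y hy0
    refine ⟨by positivity, ?_⟩
    rw [hg₂, inv_le_iff_one_le_mul₀' (pow_pos hu 2)]
    have h58 : 5 / 8 ≤ y ^ ℓ * u₀ y := hp y hy0
    have hsq : (5 / 8 : ℝ) ^ 2 ≤ (y ^ ℓ * u₀ y) ^ 2 := pow_le_pow_left₀ (by norm_num) h58 2
    calc (1 : ℝ) = 64 / 25 * (5 / 8) ^ 2 := by norm_num
      _ ≤ 64 / 25 * (y ^ ℓ * u₀ y) ^ 2 := by gcongr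
      _ = u₀ y ^ 2 * (64 / 25 * y ^ (2 * ℓ)) := by rw [pow_mul]; ring
  have hF0 : 0 ≤ F x := intervalIntegral.integral_nonneg hx fun y hy => (hg₂b y hy).1
  have hFb : F x ≤ 64 / 25 * x ^ (2 * ℓ + 1) / (2 * ℓ + 1) := by
    have hsub : uIcc x₁ x ⊆ Ioi x₀ := ordConnected_Ioi.uIcc_subset hx₁0 hxx₀
    calc F x ≤ ∫ y in x₁..x, 64 / 25 * y ^ (2 * ℓ) :=
          intervalIntegral.integral_mono_on hx ((hg₂c.mono hsub).intervalIntegrable)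
            ((continuous_const.mul (continuous_pow _)).intervalIntegrable _ _)
            fun y hy => (hg₂b y hy).2
      _ = 64 / 25 * ((x ^ (2 * ℓ + 1) - x₁ ^ (2 * ℓ + 1)) / (2 * ℓ + 1)) := by
          rw [intervalIntegral.integral_const_mul, integral_pow]; push_cast; ring
      _ ≤ 64 / 25 * x ^ (2 * ℓ + 1) / (2 * ℓ + 1) := by
          have h0 : 0 ≤ x₁ ^ (2 * ℓ + 1) := pow_nonneg (by linarith) _
          have hd : (0 : ℝ) < 2 * ℓ + 1 := by positivity
          rw [mul_div_assoc]
          gcongr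
          linarith
  have hFb' : F x ≤ 64 / 25 * x ^ (2 * ℓ + 1) := by
    refine hFb.trans ?_
    rw [div_le_iff₀ (by positivity)]
    have : (1 : ℝ) ≤ 2 * ℓ + 1 := by linarith [(Nat.cast_nonneg ℓ : (0 : ℝ) ≤ ℓ)]
    nlinarith [pow_nonneg hx0.le (2 * ℓ + 1)]
  -- `u₀ ≤ (11/8) x^{-ℓ}`, `1/u₀ ≤ (8/5) x^ℓ`, `|u₀'| ≤ (ℓ+1) x^{-ℓ-1}`
  have hu : 0 < u₀ x := hpos x hxx₀
  have hxl : 0 < x ^ ℓ := pow_pos hx0 _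
  have hxl1 : 0 < x ^ (ℓ + 1) := pow_pos hx0 _
  have hu_up : u₀ x * x ^ ℓ ≤ 11 / 8 := by rw [mul_comm]; exact hP x hxx₀
  have hinv : (u₀ x)⁻¹ ≤ 8 / 5 * x ^ ℓ := by
    rw [inv_le_iff_one_le_mul₀' hu]
    have := hp x hxx₀
    nlinarith
  have hpow1 : x ^ (2 * ℓ + 1) = x ^ ℓ * x ^ (ℓ + 1) := by rw [← pow_add]; congr 1; ring
  refine ⟨?_, ?_, ?_⟩
  · rw [e1]; exact mul_nonneg hu.le hF0
  · rw [e1]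
    calc u₀ x * F x ≤ u₀ x * (64 / 25 * x ^ (2 * ℓ + 1)) := by gcongr
      _ = 64 / 25 * (u₀ x * x ^ ℓ) * x ^ (ℓ + 1) := by rw [hpow1]; ring
      _ ≤ 64 / 25 * (11 / 8) * x ^ (ℓ + 1) := by gcongr
      _ ≤ 5 * x ^ (ℓ + 1) := by nlinarith [hxl1]
  · rw [e2]
    have hdu : |deriv u₀ x| * x ^ (ℓ + 1) ≤ ℓ + 1 := by rw [mul_comm]; exact hd x hxx₀
    have hℓ : ((ℓ : ℝ) + 1) / (2 * ℓ + 1) ≤ 1 := by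
      rw [div_le_one (by positivity)]; linarith [(Nat.cast_nonneg ℓ : (0 : ℝ) ≤ ℓ)]
    calc |deriv u₀ x * F x + (u₀ x)⁻¹| ≤ |deriv u₀ x| * F x + (u₀ x)⁻¹ := by
          refine (abs_add_le _ _).trans ?_
          rw [abs_mul, abs_of_nonneg hF0, abs_of_pos (inv_pos.2 hu)]
      _ ≤ |deriv u₀ x| * (64 / 25 * x ^ (2 * ℓ + 1) / (2 * ℓ + 1)) + 8 / 5 * x ^ ℓ := by
          gcongr
      _ = 64 / 25 * (|deriv u₀ x| * x ^ (ℓ + 1)) / (2 * ℓ + 1) * x ^ ℓ + 8 / 5 * x ^ ℓ := by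
          rw [hpow1]; ring
      _ ≤ 64 / 25 * (ℓ + 1) / (2 * ℓ + 1) * x ^ ℓ + 8 / 5 * x ^ ℓ := by gcongr
      _ = (64 / 25 * ((ℓ + 1) / (2 * ℓ + 1)) + 8 / 5) * x ^ ℓ := by ring
      _ ≤ (64 / 25 * 1 + 8 / 5) * x ^ ℓ := by gcongr
      _ ≤ 5 * x ^ ℓ := by nlinarith [hxl]

/-- **The fundamental pair in real-power form.** From the Volterra bounds on `u₀` beyond `x₀ ≥ 1`:
a partner `u₁` with Wronskian one, and on `[x₀+1, ∞)` the bounds `|u₀| ≤ (ℓ+2)x^{-ℓ}`,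
`|u₀'| ≤ (ℓ+2)x^{-ℓ-1}`, `|u₁| ≤ 5x^{ℓ+1}`, `|u₁'| ≤ 5x^ℓ`, `u₀ > 0`. [folklore] -/
theorem exists_fundamental_pair_rpow (hV : Continuous V) {ℓ : ℕ} (hx₀ : 1 ≤ x₀)
    (hu₀ : IsSchrodingerSol V u₀) (h1 : ∀ x, x₀ < x → |x ^ ℓ * u₀ x - 1| ≤ 3 / 8)
    (h2 : ∀ x, x₀ < x → |deriv u₀ x + ℓ * x ^ (-(ℓ : ℤ) - 1)| ≤ 1 / 4 * x ^ (-(ℓ : ℤ) - 1)) :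
    ∃ u₁ : ℝ → ℝ, IsSchrodingerSol V u₁ ∧ (∀ x, u₀ x * deriv u₁ x - deriv u₀ x * u₁ x = 1) ∧
      ∀ x, x₀ + 1 ≤ x →
        |u₀ x| ≤ ((ℓ : ℝ) + 2) * x ^ (-(ℓ : ℝ)) ∧
        |deriv u₀ x| ≤ ((ℓ : ℝ) + 2) * x ^ (-(ℓ : ℝ) - 1) ∧
        |u₁ x| ≤ 5 * x ^ ((ℓ : ℝ) + 1) ∧ |deriv u₁ x| ≤ 5 * x ^ (ℓ : ℝ) ∧ 0 < u₀ x := by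
  have hb : ∀ x, x₀ < x →
      5 / 8 ≤ x ^ ℓ * u₀ x ∧ x ^ ℓ * u₀ x ≤ 11 / 8 ∧ x ^ (ℓ + 1) * |deriv u₀ x| ≤ ℓ + 1 :=
    fun x hx => recessive_npow_bounds (by linarith) (h1 x hx) (h2 x hx)
  obtain ⟨u₁, hu₁, hw, hbd⟩ := exists_dominant_wronskian_one hV hx₀ hu₀ (fun x hx => (hb x hx).1)
    (fun x hx => (hb x hx).2.1) (fun x hx => (hb x hx).2.2)
  refine ⟨u₁, hu₁, hw, fun x hx => ?_⟩
  have hxx₀ : x₀ < x := by linarith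
  have hx0 : 0 < x := by linarith
  obtain ⟨h58, h118, hder⟩ := hb x hxx₀
  obtain ⟨hu₁0, hu₁b, hu₁'b⟩ := hbd x hx
  have hxl : 0 < x ^ ℓ := pow_pos hx0 _
  have hxl1 : 0 < x ^ (ℓ + 1) := pow_pos hx0 _
  have hupos : 0 < u₀ x := by
    rcases le_or_gt (u₀ x) 0 with hneg | h'
    · nlinarith [mul_nonpos_of_nonneg_of_nonpos hxl.le hneg]
    · exact h'
  -- real powers versus natural powers
  have r0 : x ^ (-(ℓ : ℝ)) = (x ^ ℓ)⁻¹ := by rw [Real.rpow_neg hx0.le, Real.rpow_natCast]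
  have r1 : x ^ (-(ℓ : ℝ) - 1) = (x ^ (ℓ + 1))⁻¹ := by
    rw [show -(ℓ : ℝ) - 1 = -((ℓ + 1 : ℕ) : ℝ) by push_cast; ring, Real.rpow_neg hx0.le,
      Real.rpow_natCast]
  have r2 : x ^ ((ℓ : ℝ) + 1) = x ^ (ℓ + 1) := by
    rw [show (ℓ : ℝ) + 1 = ((ℓ + 1 : ℕ) : ℝ) by push_cast; ring, Real.rpow_natCast]
  have r3 : x ^ (ℓ : ℝ) = x ^ ℓ := Real.rpow_natCast x ℓ
  refine ⟨?_, ?_, ?_, ?_, hupos⟩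
  · rw [r0, abs_of_pos hupos, le_mul_inv_iff₀ hxl]
    calc u₀ x * x ^ ℓ = x ^ ℓ * u₀ x := mul_comm _ _
      _ ≤ 11 / 8 := h118
      _ ≤ (ℓ : ℝ) + 2 := by linarith [(Nat.cast_nonneg ℓ : (0 : ℝ) ≤ ℓ)]
  · rw [r1, le_mul_inv_iff₀ hxl1]
    calc |deriv u₀ x| * x ^ (ℓ + 1) = x ^ (ℓ + 1) * |deriv u₀ x| := mul_comm _ _
      _ ≤ ℓ + 1 := hder
      _ ≤ (ℓ : ℝ) + 2 := by linarith
  · rw [r2, abs_of_nonneg hu₁0]; exact hu₁b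
  · rw [r3]; exact hu₁'b

end Dominant

end Literature.Analysis.ODE
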